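import Mathlib
import Literature.Analysis.Complex.BorelCaratheodoryDeriv
import HarnessLib

/-!
# Zhang (2022), §4 p. 8, Lemma 4.3: "`F′/F(s,ψ) = O(𝓛)` on `Ω₂`" from the two-sided bound
# `𝓛^{−88} ≪ |F| ≪ 𝓛^{88}` on a disc — the Borel–Carathéodory step with its constant, kernel-checked

Topic `Literature/NumberTheory/LFunctions/Zhang2022` (Landau–Siegel autopsy tree; verdict-neutral).
Y. Zhang, *Discrete mean estimates and the Landau–Siegel zero*, arXiv:2211.02515v1 (2022) — **an
unrefereed manuscript, a claimed result under adjudication** (cell pub-zhang: audit + repair census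
of arXiv:2211.02515; no claim about Landau–Siegel) — §4 p. 8:

> Lemma 4.3. Let `Ω₂ = {s : 1/2 − 𝓛⁻¹ < σ < 1 + 𝓛⁻¹, |t − 2πt₀| < 𝓛₁ + 4}`. If `s ∈ Ω₂`, then
> `F′/F(s,ψ) = O(𝓛)`.
> Proof. Assume `|w| ≤ (200𝓛)⁻¹log 𝓛`, so that `s + w ∈ Ω₁`. By Lemma 4.1 and 4.2,
> `𝓛^{−88} ≪ |F(s+w,ψ)| ≪ 𝓛^{88}`. Thus the logarithm `𝔩(s,w) := log(F(s+w,ψ)/F(s,ψ))`, which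
> vanishes at `w = 0`, is analytic in `w`, and it satisfies `Re{𝔩(s,w)} ≪ log 𝓛`. Since
> `F′/F(s,ψ) = ∂/∂w 𝔩(s,w)|_{w=0}`, the result follows by Lemma 4 of [15, Chapter 2]. □

("Lemma 4 of [15, Chapter 2]" = the Borel–Carathéodory lemma, Karatsuba, *Basic analytic number
theory*; the tree's `Literature.Analysis.Complex.norm_logDeriv_le_of_log_norm_le` is exactly the
applied form `log|F| ≤ log|F(c)| + M on |z − c| < R ⇒ |F′(c)/F(c)| ≤ 2M/R`.) This file PROVES the
lemma's inference with every constant explicit (namespace `Lemma43`):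

* `Lemma43.norm_logDeriv_le` — **Lemma 4.3's step, EXACT with its constant**: if `F` is holomorphic
  on the disc `|z − s| < R := (200𝓛)⁻¹log 𝓛` (`𝓛 > 1`) and `𝓛^{−e} ≤ |F(z)| ≤ 𝓛^{e}` there
  (`e > 0`; the manuscript's `88`, or the `79` that Lemmas 4.1–4.2 actually give), then
  `|F′/F(s)| ≤ 800·e·𝓛` (`M = 2e log 𝓛`, `2M/R = 800e𝓛`; with `e = 79` this is the cell's design
  constant `C₄₃ = 8·c_{Ω₁}·e_F = 63200`, row I-L4.3a; with the printed `88`, `70400`);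
* `Lemma43.mem_Omega1_of_mem_Omega2` — **"Assume `|w| ≤ (200𝓛)⁻¹log 𝓛`, so that `s + w ∈ Ω₁`"**,
  EXACT with the threshold it needs: for `s ∈ Ω₂` and `|w| ≤ (200𝓛)⁻¹log 𝓛`, `s + w ∈ Ω₁` provided
  `𝓛⁻¹ + (200𝓛)⁻¹log 𝓛 ≤ (100𝓛)⁻¹log 𝓛`, i.e. `log 𝓛 ≥ 200` (and `1 ≤ 𝓛₁`-free: the height
  condition only needs `(200𝓛)⁻¹log 𝓛 ≤ 1`) — one of the effective "`D ≥ D₀`" thresholds of the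
  manuscript (design row G-D0), here `𝓛 = log D ≥ e^{200}`.

What is NOT asserted: Lemmas 4.1–4.2 (the inputs `|F| ≪ 𝓛^{79}`, `FG = 1 + O(𝓛^{−227})`), hence not
Lemma 4.3 for `ψ ∈ Ψ₁` as such. Nothing about Theorems 1–2 of the source is stated or implied;
nothing here bears on the cell's verdict on (8.24).

## References

* Y. Zhang, arXiv:2211.02515v1 (2022), §4 p. 8, Lemma 4.3 and its proof; (2.7)–(2.8), Lemma 4.1
  (`Ω₁`). [cite: Zhang2022LandauSiegel, §4 Lemma 4.3]
* A. A. Karatsuba, *Basic Analytic Number Theory*, Springer 1993, Ch. 2 Lemma 4 (Borel–Carathéodory)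
  — via the tree's `Literature/Analysis/Complex/BorelCaratheodoryDeriv.lean`
  [cite: MontgomeryVaughan2007, Ch. 6, Lemma 6.2].
-/

noncomputable section

open Complex Real Metric Set

namespace Literature.NumberTheory.LFunctions.Zhang2022

namespace Lemma43

/-- **Lemma 4.3's Borel–Carathéodory step, EXACT with its constant**: `F` holomorphic on
`|z − s| < (200𝓛)⁻¹log 𝓛` with `𝓛^{−e} ≤ |F(z)| ≤ 𝓛^{e}` there (`𝓛 > 1`, `e > 0`) gives
`|F′/F(s)| ≤ 800·e·𝓛`. [cite: Zhang2022LandauSiegel, §4 Lemma 4.3] -/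
theorem norm_logDeriv_le {F : ℂ → ℂ} {s : ℂ} {L e : ℝ} (hL : 1 < L) (he : 0 < e)
    (hF : DifferentiableOn ℂ F (ball s (Real.log L / (200 * L))))
    (hlo : ∀ z ∈ ball s (Real.log L / (200 * L)), L ^ (-e) ≤ ‖F z‖)
    (hhi : ∀ z ∈ ball s (Real.log L / (200 * L)), ‖F z‖ ≤ L ^ e) :
    ‖deriv F s / F s‖ ≤ 800 * e * L := by
  have hL0 : 0 < L := by linarith
  have hlog : 0 < Real.log L := Real.log_pos hL
  set R : ℝ := Real.log L / (200 * L) with hR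
  have hR0 : 0 < R := by positivity
  have hpow : 0 < L ^ (-e) := Real.rpow_pos_of_pos hL0 _
  have hF0 : ∀ z ∈ ball s R, F z ≠ 0 := fun z hz =>
    norm_pos_iff.mp (hpow.trans_le (hlo z hz))
  -- `log|F z| ≤ e log L` and `log|F s| ≥ −e log L`
  have hs : s ∈ ball s R := mem_ball_self hR0
  have hlogF : ∀ z ∈ ball s R, Real.log ‖F z‖ ≤ Real.log ‖F s‖ + 2 * e * Real.log L := by
    intro z hz
    have h1 : Real.log ‖F z‖ ≤ e * Real.log L := by
      have := Real.log_le_log (hpow.trans_le (hlo z hz)) (hhi z hz)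
      rwa [Real.log_rpow hL0] at this
    have h2 : -e * Real.log L ≤ Real.log ‖F s‖ := by
      have := Real.log_le_log hpow (hlo s hs)
      rwa [Real.log_rpow hL0] at this
    linarith
  have hM : 0 < 2 * e * Real.log L := by positivity
  have key := Literature.Analysis.Complex.norm_logDeriv_le_of_log_norm_le hM hR0 hF hF0 hlogF
  have hval : 2 * (2 * e * Real.log L) / R = 800 * e * L := by
    rw [hR]
    field_simp
    ring
  rwa [hval] at key

/-- The same with the manuscript's exponent `88`: `|F′/F(s)| ≤ 70400·𝓛`; with the `79` of
Lemmas 4.1–4.2, `≤ 63200·𝓛` (the cell's `C₄₃`). [cite: Zhang2022LandauSiegel, §4 Lemma 4.3] -/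
theorem constants_lemma43 : (800 : ℝ) * 88 = 70400 ∧ (800 : ℝ) * 79 = 63200 := by norm_num

/-! ### "Assume `|w| ≤ (200𝓛)⁻¹log 𝓛`, so that `s + w ∈ Ω₁`" -/

/-- `Ω₁` of Lemma 4.1: `1/2 − (100𝓛)⁻¹log 𝓛 < σ < 1 + (100𝓛)⁻¹log 𝓛`, `|t − 2πt₀| < 𝓛₁ + 5`.
[cite: Zhang2022LandauSiegel, §4 Lemma 4.1] -/
def Omega1 (L L₁ t₀ : ℝ) : Set ℂ :=
  {s | 1 / 2 - Real.log L / (100 * L) < s.re ∧ s.re < 1 + Real.log L / (100 * L) ∧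
    |s.im - 2 * Real.pi * t₀| < L₁ + 5}

/-- `Ω₂` of Lemma 4.3: `1/2 − 𝓛⁻¹ < σ < 1 + 𝓛⁻¹`, `|t − 2πt₀| < 𝓛₁ + 4`.
[cite: Zhang2022LandauSiegel, §4 Lemma 4.3] -/
def Omega2 (L L₁ t₀ : ℝ) : Set ℂ :=
  {s | 1 / 2 - 1 / L < s.re ∧ s.re < 1 + 1 / L ∧ |s.im - 2 * Real.pi * t₀| < L₁ + 4}

/-- Unfolding lemma. [cite: Zhang2022LandauSiegel, §4 Lemma 4.1] -/
lemma mem_Omega1_iff (L L₁ t₀ : ℝ) (s : ℂ) : s ∈ Omega1 L L₁ t₀ ↔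
    1 / 2 - Real.log L / (100 * L) < s.re ∧ s.re < 1 + Real.log L / (100 * L) ∧
      |s.im - 2 * Real.pi * t₀| < L₁ + 5 := Iff.rfl

/-- Unfolding lemma. [cite: Zhang2022LandauSiegel, §4 Lemma 4.3] -/
lemma mem_Omega2_iff (L L₁ t₀ : ℝ) (s : ℂ) : s ∈ Omega2 L L₁ t₀ ↔
    1 / 2 - 1 / L < s.re ∧ s.re < 1 + 1 / L ∧ |s.im - 2 * Real.pi * t₀| < L₁ + 4 := Iff.rfl

/-- **"Assume `|w| ≤ (200𝓛)⁻¹log 𝓛`, so that `s + w ∈ Ω₁`"**, EXACT with the threshold it needs: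
`s ∈ Ω₂`, `|w| ≤ (200𝓛)⁻¹log 𝓛`, `𝓛 > 0`, and `log 𝓛 ≥ 200` (so that
`𝓛⁻¹ + (200𝓛)⁻¹log 𝓛 ≤ (100𝓛)⁻¹log 𝓛`) together with `(200𝓛)⁻¹log 𝓛 ≤ 1` give `s + w ∈ Ω₁`.
[cite: Zhang2022LandauSiegel, §4 Lemma 4.3 (proof)] -/
theorem mem_Omega1_of_mem_Omega2 {L L₁ t₀ : ℝ} {s w : ℂ} (hL : 0 < L)
    (hlog : 200 ≤ Real.log L) (hsmall : Real.log L / (200 * L) ≤ 1) (hs : s ∈ Omega2 L L₁ t₀)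
    (hw : ‖w‖ ≤ Real.log L / (200 * L)) : s + w ∈ Omega1 L L₁ t₀ := by
  obtain ⟨h1, h2, h3⟩ := hs
  have hre : |w.re| ≤ Real.log L / (200 * L) := (Complex.abs_re_le_norm w).trans hw
  have him : |w.im| ≤ Real.log L / (200 * L) := (Complex.abs_im_le_norm w).trans hw
  have hkey : 1 / L + Real.log L / (200 * L) ≤ Real.log L / (100 * L) := by
    rw [div_add_div _ _ hL.ne' (by positivity), div_le_div_iff₀ (by positivity) (by positivity)]
    nlinarith [mul_nonneg (mul_nonneg hL.le hL.le) (sub_nonneg.mpr hlog)]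
  obtain ⟨hre1, hre2⟩ := abs_le.mp hre
  obtain ⟨him1, him2⟩ := abs_le.mp him
  refine ⟨?_, ?_, ?_⟩
  · rw [Complex.add_re]; linarith
  · rw [Complex.add_re]; linarith
  · rw [Complex.add_im]
    have := abs_lt.mp h3
    apply abs_lt.mpr
    constructor <;> linarith

end Lemma43

end Literature.NumberTheory.LFunctions.Zhang2022
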